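import Literature.Probability.RandomPlanarGeometry.SelfAvoidingWalk
import HarnessLib

/-!
# Negative knowledge on crux `LeftRightFKG`, part 7c: fugacity-`x` weights and a certified enumeration of
self-avoiding walks

* `weightAt x Ω δ a b`: the `x^{|γ|}`-measure on the crux's carrier `SAW.DomainSAW Ω δ a b` (`x = x_c` is the
  crux's `SAW.weight`, `x = 1` is the counting measure) and its evaluation on sets (`weightAt_apply`).
* `SAWEnum.dfs` / `SAWEnum.mem_dfs`: a generic, kernel-computable and COMPLETE depth-first enumeration of the
  self-avoiding walks between two vertices of a graph with decidable adjacency — the tool by which finite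
  instances of the crux are decided by `decide` (used in `Box33`). [folklore]
-/

noncomputable section

open MeasureTheory Literature.Probability.LatticeModels Literature.Probability.RandomPlanarGeometry
open scoped ENNReal

namespace Summit.CriticalPhenomena.SAWScalingLimit.Theorems.LeftRightFKG.Negative

/-- The `x^{|γ|}`-weight on the chords of `Ω_δ` from `a` to `b` (the crux's `SAW.weight` is the case
`x = x_c`, `weightAt_criticalFugacity`). [folklore] -/
def weightAt (x : ℝ) (Ω : Set ℂ) (δ : ℝ) (a b : Site 2) : Measure (SAW.DomainSAW Ω δ a b) :=
  Measure.sum fun γ => ENNReal.ofReal (x ^ γ.length) • Measure.dirac γ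

/-- At `x = x_c`, `weightAt` is the crux's measure, definitionally. [folklore] -/
theorem weightAt_criticalFugacity (Ω : Set ℂ) (δ : ℝ) (a b : Site 2) :
    weightAt SAW.criticalFugacity Ω δ a b = SAW.weight Ω δ a b := rfl

/-- At `x = 1`, `weightAt` is the counting measure. [folklore] -/
theorem weightAt_one (Ω : Set ℂ) (δ : ℝ) (a b : Site 2) : weightAt 1 Ω δ a b = Measure.count := by
  unfold weightAt Measure.count
  congr 1
  funext γ
  rw [one_pow, ENNReal.ofReal_one, one_smul]

/-- Evaluation of `weightAt` on a set: the sum of the weights of its elements. [folklore] -/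
theorem weightAt_apply (x : ℝ) {Ω : Set ℂ} {δ : ℝ} {a b : Site 2} (S : Set (SAW.DomainSAW Ω δ a b)) :
    weightAt x Ω δ a b S = ∑' γ, S.indicator (fun γ => ENNReal.ofReal (x ^ γ.length)) γ := by
  unfold weightAt
  rw [Measure.sum_apply _ MeasurableSpace.measurableSet_top]
  congr 1
  funext γ
  rw [Measure.smul_apply, Measure.dirac_apply' _ MeasurableSpace.measurableSet_top, smul_eq_mul]
  by_cases h : γ ∈ S
  · simp [h]
  · simp [h]

/-! ## Certified depth-first enumeration of self-avoiding walks (generic) -/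

namespace SAWEnum

variable {V : Type*} [DecidableEq V] (G : SimpleGraph V) [DecidableRel G.Adj]

/-- Depth-first enumeration of the walks of `G` from `u` to `v` with at most `n` edges that extend to
self-avoiding walks avoiding `S` (candidate neighbours from the list `nbrs u`; adjacency and avoidance are
re-checked, so no hypothesis on `nbrs` is needed for typing). [folklore] -/
def dfs (nbrs : V → List V) : ℕ → List V → (u v : V) → List (G.Walk u v)
  | 0, _, u, v => if h : u = v then [SimpleGraph.Walk.nil.copy rfl h] else []
  | n + 1, S, u, v =>
    (if h : u = v then [SimpleGraph.Walk.nil.copy rfl h] else []) ++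
      (nbrs u).flatMap fun w =>
        if hw : G.Adj u w ∧ w ∉ S then (dfs nbrs n (u :: S) w v).map (SimpleGraph.Walk.cons hw.1) else []

variable {G}

/-- **Completeness of the enumeration**: every self-avoiding walk of length `≤ n` whose vertices after
the first avoid `S` is listed, provided `nbrs u` contains every neighbour of `u`. [folklore] -/
theorem mem_dfs (nbrs : V → List V) (hn : ∀ u w, G.Adj u w → w ∈ nbrs u) :
    ∀ (n : ℕ) (S : List V) {u v : V} (p : G.Walk u v), p.IsPath → p.length ≤ n →
      (∀ x ∈ p.support.tail, x ∉ S) → p ∈ dfs G nbrs n S u v := by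
  intro n
  induction n with
  | zero =>
    intro S u v p _ hl _
    have h0 : p.length = 0 := by omega
    obtain rfl := SimpleGraph.Walk.eq_of_length_eq_zero h0
    cases p with
    | nil => simp [dfs]
    | cons _ _ => simp at h0
  | succ n ih =>
    intro S u v p hp hl hS
    cases p with
    | nil => simp [dfs]
    | cons h' p' =>
      rename_i w
      rw [SimpleGraph.Walk.cons_isPath_iff] at hp
      rw [SimpleGraph.Walk.support_cons, List.tail_cons] at hS
      rw [SimpleGraph.Walk.length_cons] at hl
      have hwS : w ∉ S := hS w p'.start_mem_support
      have hmem : p' ∈ dfs G nbrs n (u :: S) w v := by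
        refine ih (u :: S) p' hp.1 (by omega) fun x hx => ?_
        simp only [List.mem_cons, not_or]
        refine ⟨?_, hS x (List.mem_of_mem_tail hx)⟩
        rintro rfl
        exact hp.2 (List.mem_of_mem_tail hx)
      simp only [dfs, List.mem_append, List.mem_flatMap]
      right
      refine ⟨w, hn u w h', ?_⟩
      rw [dif_pos ⟨h', hwS⟩]
      exact List.mem_map.2 ⟨p', hmem, rfl⟩

end SAWEnum

end Summit.CriticalPhenomena.SAWScalingLimit.Theorems.LeftRightFKG.Negative
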